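/-
Copyright (c) 2026 the pub-hodgecm-mathlib formalisation cell (harness21).  Prover seat hodgecm-mathlib-K2E3-p08 (g0),
Track B «K2-LIT» ∕ h413, unit U4 «Keys» of the line `K2_E3_EllipticInputs`: first rung of socket #6 `sig_K2E3IrregularReducibleCaseThree`
(dealer K2E3-plan (g1) DEALS BATCH #1, 2026-09-03) — `dim Hom_G(i_G(χ), i_G(χ′)) ≤ 2` FOR EVERY `χ`, AND `End_G(i_G(χ)) = ℂ·id` OFF THE `w`-FIXED LOCUS.
-/
import Summits.HodgeConjecture.HodgeConjecture.Theorems.K2E3IntertwinerCompositionScalar      -- ★ p854977 (this seat): `intertwiningMap_self_eq_smul_of_regular`; brings ★ N1 `_holds` + `_iff`, ★ F0P2p interface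
import Summits.HodgeConjecture.HodgeConjecture.Theorems.F0P2nFrobeniusCmPrincipalSeries         -- ★ `frobenius_cmPrincipalSeries` (`Hom_G(π, i_G(χ′)) ≃ₗ[ℂ] Hom_T(r_B π, ℂ_χ′)`, BZ 1.9 (b))
import Mathlib.LinearAlgebra.FreeModule.Finite.Matrix                                       -- `Module.finrank_linearMap_self`
import Mathlib.LinearAlgebra.FiniteDimensional.Basic                                        -- `finrank_eq_one_iff_of_nonzero'`
import HarnessLib

/-!
# K2_E3 road (h413 = stmt-HodgeConjecture-24833), unit U4 «Keys», first rung of #6: the commuting algebra of a principal series of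
# `U(Φ₃)(L⁺_v)` is at most two-dimensional — `dim_ℂ Hom_G(i_G(χ), i_G(χ′)) ≤ 2` for every `χ`, `χ′` — and is `ℂ·id` when `wχ ≠ χ`

Cell `pub/hodgecm-mathlib` (D-0151), Track B (21-frontier RULING «PUSH BOTH» 2026-09-03, director req624, chair K2-lead ORDER #1 ∕ #2, naming rule
s1813), dealer K2E3-plan (g1) DEALS BATCH #1 (K2/STATUS.md 2026-09-03T22:03:00Z): «p08 (★ #8) DEAL `Theorems/K2E3PSEndDimLeTwo.lean` — EVERY χ:
`dim End_G(i(χ)) ≤ 2`, and `= ℂ·id` when `wχ ≠ χ` (★ N1 `dim r_B = 2` + ★ Frobenius uniqueness) = first rung of #6 (commuting algebra = span{id, 𝒜(w,λ)})».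
Socket #6 `U4Keys.sig_K2E3IrregularReducibleCaseThree` (SIGS TABLE `K2/K2E3-plan/g0/SIGS-TABLE.K2E3-plan-g0.md` row #6, XL) is Keys' theorem in the
IRREGULAR case `wχ = χ`: «The unitary principal series `Ind_P^G λ` is reducible if and only if `λ ≠ 1`, `wλ = λ`, and `λ|F^× = 1`» [Keys1984, §7 Thm. (1)],
whose first input is Harish-Chandra's commuting-algebra theorem «THEOREM 1 (Harish-Chandra): `{U(w, λ) | w ∈ W_λ}` spans the commuting algebra»
[Keys1984, §3 Thm. 1] — for `U(Φ₃)` (`|W| = 2`) the commuting algebra is spanned by `id` and ONE operator `𝒜(w, λ)`, so has dimension `≤ 2`.  THIS FILE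
proves the dimension bound `≤ 2` for EVERY continuous `χ` (regular or not, unitary or not) and, off the `w`-fixed locus, the exact answer `ℂ·id`
(dimension `1`); the content of #6 proper (the normalised `𝒜(w, λ)` at `wλ = λ` and «reducible ⟺ `𝒜(w,λ) ∉ ℂ·id` ⟺ `λ|F^× = 1`») is NOT here.

THE MATHEMATICS (strategy: Frobenius reciprocity + the two-dimensional Jacquet module; no intertwining operator is constructed).  `G = U(Φ₃)(L⁺_v)`,
`v` a finite place of `L⁺` NON-SPLIT in `L`, `B = TN` the Borel (★ `cmBorelTriple L 3 v`), `χ = (χ₁, χ₂)` CONTINUOUS (★ `cmTorusCharPair L v χ₁ χ₂`),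
`I = i_G(χ)` = ★ `cmPrincipalSeries L 3 v (cmTorusCharPair L v χ₁ χ₂)` (smooth, ★ `isSmooth_cmPrincipalSeries`), `χ′` ANY character of `T`.
* §1 (linear algebra, any group `M`, any `M`-representation `r` on a finite-dimensional `X`, any `M`-representation `τ` on `ℂ`):
  `Hom_M(X, τ) ↪ X^∨ = (X →ₗ[ℂ] ℂ)` by `ψ ↦ ψ.toLinearMap` (injective, Mathlib `Representation.IntertwiningMap.toLinearMap_injective`), so
  `Hom_M(X, τ)` is finite-dimensional of dimension `≤ dim X` (Mathlib `Module.Finite.of_injective`, `LinearMap.finrank_le_finrank_of_injective`,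
  `Module.finrank_linearMap_self`).
* §2 Frobenius reciprocity ★ `F0P2nFrobeniusCmPrincipalSeries.frobenius_cmPrincipalSeries` [BernsteinZelevinsky1977, Prop. 1.9 (b)]:
  `Hom_G(I, i_G(χ′)) ≃ₗ[ℂ] Hom_T(r_B I, ℂ_χ′)`, and ★ N1 `U3PrincipalSeriesJacquetFiltration_holds` [Casselman1995, L. 7.1.1 (a)] (through ★ `…_iff`):
  `r_B I` is finite-dimensional with `dim r_B I = 2`.  Hence **`Hom_G(i_G(χ), i_G(χ′))` is finite-dimensional of dimension `≤ 2`**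
  (`finiteDimensional_hom_cmPrincipalSeries`, `finrank_hom_cmPrincipalSeries_le_two`), in particular **`dim End_G(i_G(χ)) ≤ 2`**
  (`finrank_end_cmPrincipalSeries_le_two`) and `dim Hom_G(i_G(χ), i_G(wχ)) ≤ 2`.
* §3 Off the `w`-fixed locus (`χ ≠ wχ = (χ̄₁⁻¹, χ₂)`, ★ `cmTorusCharPair … ≠ cmTorusCharPair (conjInvChar χ₁) χ₂`): ★ p854977
  `K2E3IntertwinerCompositionScalar.intertwiningMap_self_eq_smul_of_regular` (`B₁ ≠ 0 ⇒ B₂ = c • B₁`) at `B₁ = id ≠ 0` (★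
  `F0P2pWeylConstituentsRankOne.id_ne_zero_of_nontrivial_coinvariants`, as `dim r_B I = 2`) gives **`End_G(i_G(χ)) = ℂ·id`** (`end_eq_smul_id_of_regular`)
  and **`dim End_G(i_G(χ)) = 1`** (`finrank_end_cmPrincipalSeries_eq_one_of_regular`, Mathlib `finrank_eq_one_iff_of_nonzero'`).
Print: [Keys1984, §3 Thm. 1 (Harish-Chandra), Thm. 2 (Silberger: «The dimension of the commuting algebra of `Ind_P^G λ` is equal to `|W'_λ|`»)];
[Casselman1995, §6.4 Prop. 6.4.1: `Hom_G(i(σ), i(σ′)) ↪ Hom_M((i σ)_N, σ′δ^{1∕2})`]; [BernsteinZelevinsky1977, Thm. 2.9: `dim Hom ≤ |W|`-type bounds].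

WHAT IS NOT HERE.  Socket #6 itself (the `R`-group ∕ normalised self-intertwiner at `wλ = λ`), socket #7 (`dim Hom_G(i(χ), i(wχ)) ≤ 1` for regular `χ`,
K2E3-p07's file; §2 gives only `≤ 2` there), any statement at a SPLIT place or for discontinuous `χ` (then `i_G(χ) = 0`, ★ `subsingleton_cmPrincipalSeries_of_not_continuous`).

HONEST LABEL: HC_CM is proved only modulo the 7 printed citations (2 remaining named inputs: hLiu418 = stmt-HodgeConjecture-24832, h413 =
stmt-HodgeConjecture-24833) until rung 0 closes; this file is a `--supports stmt-HodgeConjecture-24833` helper (first rung of socket #6 of the K2_E3 road)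
and retires nothing by itself.  Theorems only: no definition, no instance, no notation, no named fact, no `sorry`; ★-only imports (no `Cruxes/…/Lines`).

## References
* [Keys1984] D. Keys, *Principal series representations of special unitary groups over local fields*, Compositio Math. 51 (1984) 115–130, §3 Thms. 1–3
  (Harish-Chandra's commuting-algebra theorem; Silberger's dimension formula), §7 Theorem (1) p. 126.
* [Casselman1995] W. Casselman, *Introduction to the theory of admissible representations of `p`-adic reductive groups* (draft 1 May 1995), §6.4
  Prop. 6.4.1 pp. 61–62, §7.1 L. 7.1.1 (a) p. 67, §3.2 Thm. 3.2.4 (Frobenius reciprocity).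
* [BernsteinZelevinsky1977] I. N. Bernstein, A. V. Zelevinsky, *Induced representations of reductive `p`-adic groups. I*, Ann. Sci. ÉNS (4) 10 (1977),
  Prop. 1.9 (b), §2.12 Geometrical Lemma, Cor. 2.13 (c), Thm. 2.9.
* [Rogawski1990] J. D. Rogawski, *Automorphic Representations of Unitary Groups in Three Variables*, Ann. of Math. Stud. 123 (1990), §12.1 p. 171, §12.2 p. 173.
-/

set_option autoImplicit false
-- the mandated namespace repeats the single-problem summit's segment (`HodgeConjecture.HodgeConjecture`)
set_option linter.dupNamespace false

noncomputable section

open NumberField IsDedekindDomain MeasureTheory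
open scoped Matrix

open Literature.NumberTheory Literature.NumberTheory.Automorphic Literature.NumberTheory.Automorphic.UnitaryGroup

namespace Summit.HodgeConjecture.HodgeConjecture.Cruxes.H413.K2E3PSEndDimLeTwo

/-! ## §1 Linear algebra: `Hom_M(X, τ) ↪ X^∨` for a one-dimensional target -/

section LinearAlgebra

variable {M : Type*} [Group M] {X : Type*} [AddCommGroup X] [Module ℂ X]

/-- The forgetful map `Hom_M(X, τ) → (X →ₗ[ℂ] ℂ)`, `ψ ↦ ψ.toLinearMap`, as a `ℂ`-linear map (target `τ` an `M`-representation on `ℂ`). [folklore] -/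
theorem exists_linearMap_toLinearMap (r : Representation ℂ M X) (τ : Representation ℂ M ℂ) :
    ∃ ι : r.IntertwiningMap τ →ₗ[ℂ] (X →ₗ[ℂ] ℂ), Function.Injective ι ∧ ∀ ψ, ι ψ = ψ.toLinearMap :=
  ⟨{ toFun := fun ψ => ψ.toLinearMap
     map_add' := fun _ _ => rfl
     map_smul' := fun _ _ => rfl },
    Representation.IntertwiningMap.toLinearMap_injective r τ, fun _ => rfl⟩

/-- **`Hom_M(X, τ)` is finite-dimensional of dimension `≤ dim X`** when `X` is finite-dimensional and `τ` is one-dimensional (on `ℂ`): it embeds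
in the dual `X^∨`, `dim X^∨ = dim X`. [folklore] [cite: Casselman1995, §6.4 Prop. 6.4.1 p. 62] -/
theorem finiteDimensional_intertwiningMap_and_finrank_le (r : Representation ℂ M X) [FiniteDimensional ℂ X] (τ : Representation ℂ M ℂ) :
    FiniteDimensional ℂ (r.IntertwiningMap τ) ∧ Module.finrank ℂ (r.IntertwiningMap τ) ≤ Module.finrank ℂ X := by
  obtain ⟨ι, hι, -⟩ := exists_linearMap_toLinearMap r τ
  haveI : FiniteDimensional ℂ (r.IntertwiningMap τ) := Module.Finite.of_injective ι hι
  refine ⟨this, ?_⟩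
  calc Module.finrank ℂ (r.IntertwiningMap τ) ≤ Module.finrank ℂ (X →ₗ[ℂ] ℂ) := LinearMap.finrank_le_finrank_of_injective hι
    _ = Module.finrank ℂ X := Module.finrank_linearMap_self ℂ ℂ X

end LinearAlgebra

/-! ## §2 `dim Hom_G(i_G(χ), i_G(χ′)) ≤ 2` for every continuous `χ` and every `χ′` -/

section CM

variable (L : Type) [Field L] [NumberField L] [IsCMField L] (v : HeightOneSpectrum (𝓞 ↥(maximalRealSubfield L)))

set_option synthInstance.maxHeartbeats 400000 in
set_option maxHeartbeats 8000000 in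
/-- **`Hom_G(i_G(χ), i_G(χ′))` is finite-dimensional of dimension at most `2`** (`G = U(Φ₃)(L⁺_v)`, `v` NON-SPLIT, `χ = (χ₁, χ₂)` CONTINUOUS, `χ′` ANY
character of the diagonal torus): Frobenius reciprocity ★ `frobenius_cmPrincipalSeries` identifies it with `Hom_T(r_B i_G(χ), ℂ_χ′)`, which embeds in the
dual of the two-dimensional (★ N1) Jacquet module `r_B i_G(χ)` (§1).  [cite: BernsteinZelevinsky1977, Prop. 1.9 (b); Cor. 2.13 (c); Thm. 2.9]
[cite: Casselman1995, §6.4 Prop. 6.4.1 p. 62; §7.1 L. 7.1.1 (a) p. 67] [cite: Keys1984, §3 Thm. 2] [cite: Rogawski1990, §12.2 p. 173] -/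
theorem finiteDimensional_hom_and_finrank_le_two
    (hns : ∀ w : PlacesOver L v, IsCMField.complexConj L • w.1 = w.1)
    (χ₁ : (LocalRing L v)ˣ →* ℂˣ) (χ₂ : ↥(normOneUnits (conjLocal L (IsCMField.complexConj L) v)) →* ℂˣ)
    (h₁ : Continuous fun x => ((χ₁ x : ℂˣ) : ℂ)) (h₂ : Continuous fun x => ((χ₂ x : ℂˣ) : ℂ))
    (χ' : ↥(torusU (conjLocal L (IsCMField.complexConj L) v) (cmLocalForm L 3 v)) →* ℂˣ) :
    FiniteDimensional ℂ ((cmPrincipalSeries L 3 v (cmTorusCharPair L v χ₁ χ₂)).IntertwiningMap (cmPrincipalSeries L 3 v χ')) ∧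
    Module.finrank ℂ ((cmPrincipalSeries L 3 v (cmTorusCharPair L v χ₁ χ₂)).IntertwiningMap (cmPrincipalSeries L 3 v χ')) ≤ 2 := by
  haveI := locallyCompactSpace_cmBorelU L 3 v
  -- ★ N1 (conjuncts 1–2): `r_B i_G(χ)` finite-dimensional, `dim = 2`
  obtain ⟨hfd, hX2, -⟩ := (UnitaryGroup.U3PrincipalSeriesJacquetFiltration_iff L).1
    (F0P3U3PrincipalSeriesJacquetFiltrationHolds.U3PrincipalSeriesJacquetFiltration_holds L) v hns χ₁ χ₂ h₁ h₂
  haveI := hfd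
  -- ★ Frobenius reciprocity for the smooth `π = i_G(χ)` into `i_G(χ′)`
  obtain ⟨e⟩ := F0P2nFrobeniusCmPrincipalSeries.frobenius_cmPrincipalSeries L v χ'
    (cmPrincipalSeries L 3 v (cmTorusCharPair L v χ₁ χ₂)) (F0P2pCmPrincipalSeriesInterface.isSmooth_cmPrincipalSeries L v _)
  -- §1 on the Jacquet side, transported along `e`
  obtain ⟨hfin, hle⟩ := finiteDimensional_intertwiningMap_and_finrank_le
    ((cmPrincipalSeries L 3 v (cmTorusCharPair L v χ₁ χ₂)).normalizedJacquet (cmBorelTriple L 3 v))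
    ((Representation.trivial ℂ ↥(torusU (conjLocal L (IsCMField.complexConj L) v) (cmLocalForm L 3 v)) ℂ).twist χ')
  haveI := hfin
  refine ⟨Module.Finite.equiv e.symm, ?_⟩
  rw [LinearEquiv.finrank_eq e]
  exact hle.trans hX2.le

set_option synthInstance.maxHeartbeats 400000 in
set_option maxHeartbeats 8000000 in
/-- **`Hom_G(i_G(χ), i_G(χ′))` is finite-dimensional** (`v` non-split, `χ` continuous, `χ′` arbitrary). [cite: BernsteinZelevinsky1977, Prop. 1.9 (b)]
[cite: Casselman1995, §6.4 Prop. 6.4.1 p. 62] -/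
theorem finiteDimensional_hom_cmPrincipalSeries
    (hns : ∀ w : PlacesOver L v, IsCMField.complexConj L • w.1 = w.1)
    (χ₁ : (LocalRing L v)ˣ →* ℂˣ) (χ₂ : ↥(normOneUnits (conjLocal L (IsCMField.complexConj L) v)) →* ℂˣ)
    (h₁ : Continuous fun x => ((χ₁ x : ℂˣ) : ℂ)) (h₂ : Continuous fun x => ((χ₂ x : ℂˣ) : ℂ))
    (χ' : ↥(torusU (conjLocal L (IsCMField.complexConj L) v) (cmLocalForm L 3 v)) →* ℂˣ) :
    FiniteDimensional ℂ ((cmPrincipalSeries L 3 v (cmTorusCharPair L v χ₁ χ₂)).IntertwiningMap (cmPrincipalSeries L 3 v χ')) :=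
  (finiteDimensional_hom_and_finrank_le_two L v hns χ₁ χ₂ h₁ h₂ χ').1

set_option synthInstance.maxHeartbeats 400000 in
set_option maxHeartbeats 8000000 in
/-- **`dim_ℂ Hom_G(i_G(χ), i_G(χ′)) ≤ 2`** (`v` non-split, `χ` continuous, `χ′` arbitrary; the module IS finite-dimensional,
`finiteDimensional_hom_cmPrincipalSeries`, so the bound is not the junk value of `finrank`).  [cite: BernsteinZelevinsky1977, Prop. 1.9 (b), Thm. 2.9]
[cite: Casselman1995, §6.4 Prop. 6.4.1 p. 62; §7.1 L. 7.1.1 (a) p. 67] [cite: Keys1984, §3 Thm. 2] -/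
theorem finrank_hom_cmPrincipalSeries_le_two
    (hns : ∀ w : PlacesOver L v, IsCMField.complexConj L • w.1 = w.1)
    (χ₁ : (LocalRing L v)ˣ →* ℂˣ) (χ₂ : ↥(normOneUnits (conjLocal L (IsCMField.complexConj L) v)) →* ℂˣ)
    (h₁ : Continuous fun x => ((χ₁ x : ℂˣ) : ℂ)) (h₂ : Continuous fun x => ((χ₂ x : ℂˣ) : ℂ))
    (χ' : ↥(torusU (conjLocal L (IsCMField.complexConj L) v) (cmLocalForm L 3 v)) →* ℂˣ) :
    Module.finrank ℂ ((cmPrincipalSeries L 3 v (cmTorusCharPair L v χ₁ χ₂)).IntertwiningMap (cmPrincipalSeries L 3 v χ')) ≤ 2 :=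
  (finiteDimensional_hom_and_finrank_le_two L v hns χ₁ χ₂ h₁ h₂ χ').2

set_option synthInstance.maxHeartbeats 400000 in
set_option maxHeartbeats 8000000 in
/-- **The commuting algebra of `i_G(χ)` has dimension `≤ 2`** for EVERY continuous `χ = (χ₁, χ₂)` at a non-split `v` — the in-house half of Silberger's
«The dimension of the commuting algebra of `Ind_P^G λ` is equal to `|W'_λ|`» (`|W| = 2` for `U(Φ₃)`): `End_G(i_G(χ))` is finite-dimensional and
`dim_ℂ End_G(i_G(χ)) ≤ 2`.  (Irregular `wχ = χ` included; the exact value there — `1` or `2` according as the normalised `𝒜(w, λ)` is scalar — is socket #6's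
content and is NOT claimed.)  [cite: Keys1984, §3 Thms. 1–2; §7 Theorem (1) p. 126] [cite: Casselman1995, §6.4 Prop. 6.4.1 p. 62] [cite: BernsteinZelevinsky1977, Prop. 1.9 (b), Thm. 2.9] -/
theorem finrank_end_cmPrincipalSeries_le_two
    (hns : ∀ w : PlacesOver L v, IsCMField.complexConj L • w.1 = w.1)
    (χ₁ : (LocalRing L v)ˣ →* ℂˣ) (χ₂ : ↥(normOneUnits (conjLocal L (IsCMField.complexConj L) v)) →* ℂˣ)
    (h₁ : Continuous fun x => ((χ₁ x : ℂˣ) : ℂ)) (h₂ : Continuous fun x => ((χ₂ x : ℂˣ) : ℂ)) :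
    FiniteDimensional ℂ ((cmPrincipalSeries L 3 v (cmTorusCharPair L v χ₁ χ₂)).IntertwiningMap (cmPrincipalSeries L 3 v (cmTorusCharPair L v χ₁ χ₂))) ∧
    Module.finrank ℂ ((cmPrincipalSeries L 3 v (cmTorusCharPair L v χ₁ χ₂)).IntertwiningMap (cmPrincipalSeries L 3 v (cmTorusCharPair L v χ₁ χ₂))) ≤ 2 :=
  finiteDimensional_hom_and_finrank_le_two L v hns χ₁ χ₂ h₁ h₂ (cmTorusCharPair L v χ₁ χ₂)

set_option synthInstance.maxHeartbeats 400000 in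
set_option maxHeartbeats 8000000 in
/-- **`dim_ℂ Hom_G(i_G(χ), i_G(wχ)) ≤ 2`** for every continuous `χ` at a non-split `v` (`wχ = (χ̄₁⁻¹, χ₂)` spelled ★ `cmTorusCharPair … (conjInvChar χ₁) χ₂`),
with finite-dimensionality; the sharp `≤ 1` for regular `χ` is socket #7. [cite: BernsteinZelevinsky1977, Prop. 1.9 (b), Thm. 2.9] [cite: Casselman1995, §6.4 Prop. 6.4.1 p. 62] -/
theorem finrank_hom_cmPrincipalSeries_weylConj_le_two
    (hns : ∀ w : PlacesOver L v, IsCMField.complexConj L • w.1 = w.1)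
    (χ₁ : (LocalRing L v)ˣ →* ℂˣ) (χ₂ : ↥(normOneUnits (conjLocal L (IsCMField.complexConj L) v)) →* ℂˣ)
    (h₁ : Continuous fun x => ((χ₁ x : ℂˣ) : ℂ)) (h₂ : Continuous fun x => ((χ₂ x : ℂˣ) : ℂ)) :
    FiniteDimensional ℂ ((cmPrincipalSeries L 3 v (cmTorusCharPair L v χ₁ χ₂)).IntertwiningMap
        (cmPrincipalSeries L 3 v (cmTorusCharPair L v (conjInvChar (conjLocal L (IsCMField.complexConj L) v) χ₁) χ₂))) ∧
    Module.finrank ℂ ((cmPrincipalSeries L 3 v (cmTorusCharPair L v χ₁ χ₂)).IntertwiningMap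
        (cmPrincipalSeries L 3 v (cmTorusCharPair L v (conjInvChar (conjLocal L (IsCMField.complexConj L) v) χ₁) χ₂))) ≤ 2 :=
  finiteDimensional_hom_and_finrank_le_two L v hns χ₁ χ₂ h₁ h₂ _

/-! ## §3 Off the `w`-fixed locus: `End_G(i_G(χ)) = ℂ·id`, dimension `1` -/

set_option synthInstance.maxHeartbeats 400000 in
set_option maxHeartbeats 8000000 in
/-- **`End_G(i_G(χ)) = ℂ·id` for REGULAR `χ`** (`χ ≠ wχ`, `v` non-split, `χ` continuous): every endomorphism `E` of `i_G(χ)` is `c • id`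
(★ p854977 `intertwiningMap_self_eq_smul_of_regular` at `B₁ = id`, which is non-zero because `dim r_B i_G(χ) = 2` makes `i_G(χ) ≠ 0`, ★
`id_ne_zero_of_nontrivial_coinvariants`).  For `U(Φ₃)` off the `w`-fixed locus this is Harish-Chandra's commuting-algebra theorem with `W_λ = 1`.
[cite: Keys1984, §3 Thm. 1] [cite: Casselman1995, §6.4 Prop. 6.4.1 p. 62; §7.1 L. 7.1.1 (a) p. 67] [cite: BernsteinZelevinsky1977, Prop. 1.9 (b)] -/
theorem end_eq_smul_id_of_regular
    (hns : ∀ w : PlacesOver L v, IsCMField.complexConj L • w.1 = w.1)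
    (χ₁ : (LocalRing L v)ˣ →* ℂˣ) (χ₂ : ↥(normOneUnits (conjLocal L (IsCMField.complexConj L) v)) →* ℂˣ)
    (h₁ : Continuous fun x => ((χ₁ x : ℂˣ) : ℂ)) (h₂ : Continuous fun x => ((χ₂ x : ℂˣ) : ℂ))
    (hreg : cmTorusCharPair L v χ₁ χ₂ ≠ cmTorusCharPair L v (conjInvChar (conjLocal L (IsCMField.complexConj L) v) χ₁) χ₂)
    (E : (cmPrincipalSeries L 3 v (cmTorusCharPair L v χ₁ χ₂)).IntertwiningMap (cmPrincipalSeries L 3 v (cmTorusCharPair L v χ₁ χ₂))) :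
    ∃ c : ℂ, E = c • Representation.IntertwiningMap.id (cmPrincipalSeries L 3 v (cmTorusCharPair L v χ₁ χ₂)) := by
  haveI := locallyCompactSpace_cmBorelU L 3 v
  obtain ⟨-, hX2, -⟩ := (UnitaryGroup.U3PrincipalSeriesJacquetFiltration_iff L).1
    (F0P3U3PrincipalSeriesJacquetFiltrationHolds.U3PrincipalSeriesJacquetFiltration_holds L) v hns χ₁ χ₂ h₁ h₂
  have hid : Representation.IntertwiningMap.id (cmPrincipalSeries L 3 v (cmTorusCharPair L v χ₁ χ₂)) ≠ 0 :=
    F0P2pWeylConstituentsRankOne.id_ne_zero_of_nontrivial_coinvariants (cmBorelTriple L 3 v) _ (Module.nontrivial_of_finrank_eq_succ hX2)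
  exact K2E3IntertwinerCompositionScalar.intertwiningMap_self_eq_smul_of_regular L v hns χ₁ χ₂ h₁ h₂ hreg
    (Representation.IntertwiningMap.id _) E hid

set_option synthInstance.maxHeartbeats 400000 in
set_option maxHeartbeats 8000000 in
/-- **`dim_ℂ End_G(i_G(χ)) = 1` for REGULAR `χ`** (`χ ≠ wχ`, `v` non-split, `χ` continuous): `End_G(i_G(χ))` is finite-dimensional (§2) and spanned by the
non-zero vector `id` (§3 `end_eq_smul_id_of_regular`).  Silberger's formula `dim = |W'_λ| = 1` off the `w`-fixed locus.
[cite: Keys1984, §3 Thms. 1–2] [cite: Casselman1995, §6.4 Prop. 6.4.1 p. 62] [cite: BernsteinZelevinsky1977, Prop. 1.9 (b), Thm. 2.9] -/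
theorem finrank_end_cmPrincipalSeries_eq_one_of_regular
    (hns : ∀ w : PlacesOver L v, IsCMField.complexConj L • w.1 = w.1)
    (χ₁ : (LocalRing L v)ˣ →* ℂˣ) (χ₂ : ↥(normOneUnits (conjLocal L (IsCMField.complexConj L) v)) →* ℂˣ)
    (h₁ : Continuous fun x => ((χ₁ x : ℂˣ) : ℂ)) (h₂ : Continuous fun x => ((χ₂ x : ℂˣ) : ℂ))
    (hreg : cmTorusCharPair L v χ₁ χ₂ ≠ cmTorusCharPair L v (conjInvChar (conjLocal L (IsCMField.complexConj L) v) χ₁) χ₂) :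
    Module.finrank ℂ ((cmPrincipalSeries L 3 v (cmTorusCharPair L v χ₁ χ₂)).IntertwiningMap (cmPrincipalSeries L 3 v (cmTorusCharPair L v χ₁ χ₂))) = 1 := by
  haveI := locallyCompactSpace_cmBorelU L 3 v
  obtain ⟨-, hX2, -⟩ := (UnitaryGroup.U3PrincipalSeriesJacquetFiltration_iff L).1
    (F0P3U3PrincipalSeriesJacquetFiltrationHolds.U3PrincipalSeriesJacquetFiltration_holds L) v hns χ₁ χ₂ h₁ h₂
  have hid : Representation.IntertwiningMap.id (cmPrincipalSeries L 3 v (cmTorusCharPair L v χ₁ χ₂)) ≠ 0 :=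
    F0P2pWeylConstituentsRankOne.id_ne_zero_of_nontrivial_coinvariants (cmBorelTriple L 3 v) _ (Module.nontrivial_of_finrank_eq_succ hX2)
  haveI := finiteDimensional_hom_cmPrincipalSeries L v hns χ₁ χ₂ h₁ h₂ (cmTorusCharPair L v χ₁ χ₂)
  rw [finrank_eq_one_iff_of_nonzero' _ hid]
  intro E
  obtain ⟨c, hc⟩ := end_eq_smul_id_of_regular L v hns χ₁ χ₂ h₁ h₂ hreg E
  exact ⟨c, hc.symm⟩

end CM

end Summit.HodgeConjecture.HodgeConjecture.Cruxes.H413.K2E3PSEndDimLeTwo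

end
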